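import Summits.QuantumFields.YangMills.Theses.LimitSetRigidity

/-!
# Birth skeleton (BC3) for the deciding crux `LimitSetRigidity.IsolatedLimitPointsL`

Two registered stubs + the kernel-checked composition `IsolatedLimitPointsL_of`.
* `stub_determiningLoops` — FINITE-DIMENSIONAL REDUCTION («determining loops», the Foias–Prodi move): near each other,
  subsequential limit functionals are Lipschitz-slaved to finitely many loop coordinates `T`.
* `stub_discreteTestValues` — DISCRETENESS IN FINITE DIMENSION: for every finite loop set `T'` the joint limit values on `T'`
  form a uniformly discrete (hence finite) subset of `ℝ^{T'}` (local uniqueness of the finite-dimensional fixed-point problem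
  for the relevant coordinates; implicit-function theorem in Bałaban's analytic norm).
Neither stub gives the crux alone (closeness ≠ equality; agreement on `T'` ≠ agreement everywhere).
-/

namespace Summit.QuantumFields.YangMills.Theses.LimitSetRigidity

-- the crux decl `IsolatedLimitPointsL` is the ROUTE FILE's (imported above); the composition below concludes it BY NAME
open scoped BigOperators Topology
open Filter

namespace Cruxes.IsolatedLimitPointsL.Birth

open Literature.MathematicalPhysics.QuantumFieldTheory.Balaban1983to89
  Literature.MathematicalPhysics.QuantumFieldTheory.Balaban1983to89.T3ContinuumYM3Torus
  Literature.MathematicalPhysics.QuantumFieldTheory.Balaban1983to89.T3UnitLawDensityEML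

/-- STUB 1 (determining loops; size M–L): there are finitely many loop strings `T`, a radius `ρ > 0` and a constant `C`
such that two subsequential limit functionals that are `ρ`-close on `T` differ, on EVERY loop string, by at most
`C ·` (their ℓ¹-distance on `T`). -/
theorem stub_determiningLoops :
    ∃ γ₁ : ℝ, 0 < γ₁ ∧ ∀ (F : T3Family) (γ : ℝ), 0 < γ → γ ≤ γ₁ →
      ∃ (T : Finset (List (ULoop3 F))) (ρ C : ℝ), 0 < ρ ∧
        ∀ (φ ψ : ℕ → ℕ) (E E' : List (ULoop3 F) → ℝ), StrictMono φ → StrictMono ψ →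
          Missing.IsLimitFunctional (fun K => (F.scheme ℰp γ).expectAt (φ K)) E →
          Missing.IsLimitFunctional (fun K => (F.scheme ℰp γ).expectAt (ψ K)) E' →
          (∀ Cs ∈ T, |E Cs - E' Cs| < ρ) →
            ∀ Cs : List (ULoop3 F), |E Cs - E' Cs| ≤ C * ∑ Ds ∈ T, |E Ds - E' Ds| := by
  sorry

/-- STUB 2 (discrete test values; size L — the hard one): for every finite set `T'` of loop strings there is `δ > 0` such
that two subsequential limit functionals that are `δ`-close on `T'` AGREE on `T'` (the joint limit values on `T'` form a
uniformly discrete subset of `ℝ^{T'}`). -/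
theorem stub_discreteTestValues :
    ∃ γ₁ : ℝ, 0 < γ₁ ∧ ∀ (F : T3Family) (γ : ℝ), 0 < γ → γ ≤ γ₁ →
      ∀ T' : Finset (List (ULoop3 F)), ∃ δ : ℝ, 0 < δ ∧
        ∀ (φ ψ : ℕ → ℕ) (E E' : List (ULoop3 F) → ℝ), StrictMono φ → StrictMono ψ →
          Missing.IsLimitFunctional (fun K => (F.scheme ℰp γ).expectAt (φ K)) E →
          Missing.IsLimitFunctional (fun K => (F.scheme ℰp γ).expectAt (ψ K)) E' →
          (∀ Cs ∈ T', |E Cs - E' Cs| < δ) → ∀ Cs ∈ T', E Cs = E' Cs := by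
  sorry

/-- COMPOSITION (kernel-checked, no sorry): the two stubs give the crux BY NAME. -/
theorem IsolatedLimitPointsL_of
    (h₁ : ∃ γ₁ : ℝ, 0 < γ₁ ∧ ∀ (F : T3Family) (γ : ℝ), 0 < γ → γ ≤ γ₁ →
      ∃ (T : Finset (List (ULoop3 F))) (ρ C : ℝ), 0 < ρ ∧
        ∀ (φ ψ : ℕ → ℕ) (E E' : List (ULoop3 F) → ℝ), StrictMono φ → StrictMono ψ →
          Missing.IsLimitFunctional (fun K => (F.scheme ℰp γ).expectAt (φ K)) E →
          Missing.IsLimitFunctional (fun K => (F.scheme ℰp γ).expectAt (ψ K)) E' →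
          (∀ Cs ∈ T, |E Cs - E' Cs| < ρ) →
            ∀ Cs : List (ULoop3 F), |E Cs - E' Cs| ≤ C * ∑ Ds ∈ T, |E Ds - E' Ds|)
    (h₂ : ∃ γ₁ : ℝ, 0 < γ₁ ∧ ∀ (F : T3Family) (γ : ℝ), 0 < γ → γ ≤ γ₁ →
      ∀ T' : Finset (List (ULoop3 F)), ∃ δ : ℝ, 0 < δ ∧
        ∀ (φ ψ : ℕ → ℕ) (E E' : List (ULoop3 F) → ℝ), StrictMono φ → StrictMono ψ →
          Missing.IsLimitFunctional (fun K => (F.scheme ℰp γ).expectAt (φ K)) E →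
          Missing.IsLimitFunctional (fun K => (F.scheme ℰp γ).expectAt (ψ K)) E' →
          (∀ Cs ∈ T', |E Cs - E' Cs| < δ) → ∀ Cs ∈ T', E Cs = E' Cs) :
    Summit.QuantumFields.YangMills.Theses.LimitSetRigidity.IsolatedLimitPointsL := by
  obtain ⟨γ₁, hγ₁, h₁⟩ := h₁
  obtain ⟨γ₂, hγ₂, h₂⟩ := h₂
  refine ⟨min γ₁ γ₂, lt_min hγ₁ hγ₂, fun F γ hγ hle => ?_⟩
  obtain ⟨T, ρ, C, hρ, hT⟩ := h₁ F γ hγ (hle.trans (min_le_left _ _))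
  obtain ⟨δ, hδ, hD⟩ := h₂ F γ hγ (hle.trans (min_le_right _ _)) T
  refine ⟨T, min ρ δ, lt_min hρ hδ, fun φ ψ E E' hφ hψ hE hE' hclose => ?_⟩
  have hT' := hT φ ψ E E' hφ hψ hE hE' fun Cs hCs => (hclose Cs hCs).trans_le (min_le_left _ _)
  have hD' := hD φ ψ E E' hφ hψ hE hE' fun Cs hCs => (hclose Cs hCs).trans_le (min_le_right _ _)
  have hzero : ∑ Ds ∈ T, |E Ds - E' Ds| = 0 :=
    Finset.sum_eq_zero fun Ds hDs => by rw [hD' Ds hDs, sub_self, abs_zero]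
  funext Cs
  have := hT' Cs
  rw [hzero, mul_zero] at this
  exact sub_eq_zero.mp (abs_nonpos_iff.mp this)

/-- The composition applied to the stubs: the crux, modulo exactly the two sorries above. -/
theorem isolatedLimitPointsL_of_stubs : Summit.QuantumFields.YangMills.Theses.LimitSetRigidity.IsolatedLimitPointsL :=
  IsolatedLimitPointsL_of stub_determiningLoops stub_discreteTestValues

end Cruxes.IsolatedLimitPointsL.Birth

end Summit.QuantumFields.YangMills.Theses.LimitSetRigidity
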